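import Summits.BirchSwinnertonDyer.BirchSwinnertonDyer.Theses.KatoDescentPotSupersingular
import Summits.BirchSwinnertonDyer.BirchSwinnertonDyer.Theorems.KatoDescentPotSupersingularMemberHullZetaInputsOfCore
import Summits.BirchSwinnertonDyer.BirchSwinnertonDyer.Theorems.KatoDescentPotSupersingularReducibleKatoMemberZetaInputsDescent
import HarnessLib

/-!
# Route `KatoDescentPotSupersingular` (rung K9, cell `bsd-potss`): the shared crux M `ReducibleKatoMember`
# (item stmt-BirchSwinnertonDyer-19196) from the RE-KEYED held inputs — modularity, Kato's CORE member package
# `Kato2004.exists_memberHullZetaCoreInputs` (p630270; zeta package minus the COUNT and INDEX clauses, plus the two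
# printed inputs (b′) zeta-line local index / (c2′) order of `𝐇²/X𝐇²`), the Poitou–Tate duality fact and
# Gross–Zagier–Kolyvagin — typed closer over the route-free node
# `MemberHullZetaInputsOfCore.exists_memberHullZetaInputs_of_coreInputs` (seat `bsd-potss-rkm` g21; planner TARGET R265)

WHAT.  `reducibleKatoMember_of_newformZ_of_coreInputs : PublishedInputNewformKatoZ → exists_memberHullZetaCoreInputs →
poitouTate_selmerStructure_duality ℚ → PublishedInputRankEqAnalyticRankZ → ReducibleKatoMember` — the glue term for the
planner's gen-4 resplit of crux M `{20296 modularity, NEW HELD PublishedInputMemberHullZetaCore := exists_memberHullZetaCoreInputs,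
HELD alias of poitouTate_selmerStructure_duality ℚ, 20298 GZK}` (the two new clauses (b′)/(c2′) are CLAUSES of the core package,
not free-standing nodes: they speak about the package's existential `λ(0)` and `𝐇²`).  Proof: the core fact gives the zeta fact
(`exists_memberHullZetaInputs_of_coreInputs`: Kato's Thm. 14.5 (2) and Prop. 14.16 (2) re-derived in the kernel from (b′), (c2′) and
the Poitou–Tate fact, parts 47–61), then rkm g13's route-free node `ZetaInputsDescent.katoMemberShaBoundOfReducible_of_newform_of_zetaInputs` (the route decl unfolds by `rfl` to `O6.KatoMemberShaBoundOfReducible`).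
HONEST FRAMING: conditional on the four named facts (cite-level published inputs, no `_holds` expected); the item is NOT closed by
this file; nothing is booked; BSD is not advanced.

References: K. Kato, Astérisque 295 (2004), Thm. 12.5/12.6 (p. 222), Lemma 13.10 (1), Thm. 14.5 (2) (p. 236), (14.9.3) (p. 240),
(14.14.1)–(14.14.2) (p. 243), Prop. 14.16 (2) (pp. 244–245), Lemma 14.18 (pp. 247–248) [Kato2004Asterisque]; C.-H. Kim, AJM 148 §3.2.3
[Kim2022StructureSelmer]; J. S. Milne, *ADT* I Thm. 4.10 [MilneADT2006]; H. Darmon, CBMS 101 Thm. 3.22 [Darmon2004].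
-/

set_option autoImplicit false
-- sibling precedent: the directory name repeats the summit name
set_option linter.dupNamespace false

noncomputable section

namespace Summit.BirchSwinnertonDyer.BirchSwinnertonDyer.Theorems

open Literature.NumberTheory.EllipticCurves Literature.NumberTheory.EllipticCurves.ModularForms
  Literature.NumberTheory.EllipticCurves.Kato2004 Literature.NumberTheory.GaloisCohomology
open Summit.BirchSwinnertonDyer.BirchSwinnertonDyer.Theses.KatoDescentPotSupersingular

/-- **The K9 crux `ReducibleKatoMember` (item stmt-BirchSwinnertonDyer-19196; conclusion = the route decl by name) from the
re-keyed held inputs**: `PublishedInputNewformKatoZ → Kato2004.exists_memberHullZetaCoreInputs →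
poitouTate_selmerStructure_duality ℚ → PublishedInputRankEqAnalyticRankZ → ReducibleKatoMember` (modularity; Kato's CORE member package
with the printed inputs (b′) zeta-line index at `p` and (c2′) order of `𝐇²/X𝐇²`; Poitou–Tate; Gross–Zagier–Kolyvagin).  The aliases unfold by
`rfl`.  Conditional on the four named facts; the item is not closed by this theorem.
[cite: Kato2004Asterisque, Thm. 14.5 (2) (p. 236), (14.9.3) (p. 240), (14.14.2) (p. 243), Prop. 14.16 (2) (pp. 244–245), Lemma 14.18 (pp. 247–248)]
[cite: Kim2022StructureSelmer, §3.2.3] [cite: MilneADT2006, Ch. I, Thm. 4.10 (b)] [cite: Darmon2004, Thm. 3.22] -/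
theorem reducibleKatoMember_of_newformZ_of_coreInputs (hN : PublishedInputNewformKatoZ)
    (hC : Kato2004.exists_memberHullZetaCoreInputs) (hPT : poitouTate_selmerStructure_duality ℚ)
    (hG : PublishedInputRankEqAnalyticRankZ) :
    Summit.BirchSwinnertonDyer.BirchSwinnertonDyer.Theses.KatoDescentPotSupersingular.ReducibleKatoMember :=
  ZetaInputsDescent.katoMemberShaBoundOfReducible_of_newform_of_zetaInputs hN
    (MemberHullZetaInputsOfCore.exists_memberHullZetaInputs_of_coreInputs hG hPT hC)

end Summit.BirchSwinnertonDyer.BirchSwinnertonDyer.Theorems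

end
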